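import Literature.Probability.RandomPlanarGeometry.HexSAWStripBridgeRenewal
import HarnessLib

/-!
# The horizontal bridges with exactly `n` steps at the strip threshold: `Σ_{|h| = n+1} x_c^{|h|−1} y_T^{#top(h.tail)} ≤ K_T` uniformly in `n`
# (the length-pointwise law — the renewal structure sliced by length; twin of `HexSAWStripBridgeSpanPointwise`)

Topic `Literature/Probability/RandomPlanarGeometry` (continues `HexSAWStripBridgeDecomposition.lean` / `HexSAWStripBridgeRenewal.lean`; same sources and the same proof as
`HexSAWStripBridgeSpanPointwise.lean` with the horizontal span replaced by the number of steps — both functionals are additive at renewal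
splits, translation invariant, and `≥ 1` on every piece).  Sources: Duminil-Copin–Hammond, CMP 324 (2013) §2.2; Seneta (1973) §6.1–§6.2;
Beaton et al., CMP 326 (2014), arXiv:1109.0358v5, Corollary 8 (`y_T`).  The bound is the lane's; nothing of the kind is printed.

## What is proved (namespace `Literature.Probability.RandomPlanarGeometry.SAW.HV`; `T ≥ 1`)

* `hlen l = |l| − 1`; length slices `LUset/LMset/LUs/LMs/LUM/LMM`; `LUM_le_split` (first-renewal split), `LUM_mulVec_le_of_subInvariant`
  (`U_n(y) s ≤ s` for a sub-invariant `s` of `I(y)`, `y ∈ [1,y_T)`), `exists_LUM_le`, ★★★ `exists_LUs_stripYT_le` —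
  `∃ K, ∀ N n a b, LUs T N n a b (y_T) ≤ K`: the standard horizontal bridges `a → b` with exactly `n` steps have total weight
  `x_c^{n} y_T^{#top(tail)} ≤ K` at the threshold, uniformly in `n`; ★★★ `exists_hBridgesN_length_stripYT_le` — the same for the full
  weight `x_c^{|h|} y_T^{#top(h)}` summed over `hBridgesN T N` at fixed length.

Purpose (lane «pcv-sawmu», a-p2 g17): the input for the pointwise-in-length laws of the β-walks and of the chains of the strip at `y_T`
(`x_c^n Z_{T,n}(y_T) ≍ 1`: no polynomial correction — the strip's "γ = 1").  NOT claimed: convergence in `n`.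
-/

noncomputable section

open Finset Filter Topology Matrix Literature.Probability.LatticeModels Literature.Probability.Percolation Literature.Analysis.Matrix

namespace Literature.Probability.RandomPlanarGeometry.SAW.HV

/-! ### §1 The horizontal span of a bridge and the length-sliced classes -/

/-- The number of steps of a vertex list, as an integer: `|l| − 1`. [cite: DuminilCopinHammond2013, §2.2 (the length of a bridge); lane] -/
def hlen (l : List HV) : ℤ := (l.length : ℤ) - 1

section LenSliced

variable {T : ℕ}

/-- Standard horizontal bridges `a → b` (at most `N + 1` vertices) with exactly `σ` steps (plumbing). [folklore] -/
def LUset (T N : ℕ) (σ : ℤ) (a b : ℤ) : Finset (List HV) := (HBab T N a b).filter fun l => hlen l = σ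

/-- Irreducible standard horizontal bridges `a → b` with exactly `σ` steps (plumbing). [folklore] -/
def LMset (T N : ℕ) (σ : ℤ) (a b : ℤ) : Finset (List HV) := (HBk T N 1 a b).filter fun l => hlen l = σ

/-- `U_σ(a,b)(y) = Σ x_c^{|h|−1} y^{#top(h.tail)}` over the bridges with `σ` steps (plumbing). [folklore] -/
def LUs (T N : ℕ) (σ : ℤ) (a b : ℤ) (y : ℝ) : ℝ := ∑ l ∈ LUset T N σ a b, wD T y l

/-- `M_σ(a,b)(y)` over the irreducible bridges with `σ` steps (plumbing). [folklore] -/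
def LMs (T N : ℕ) (σ : ℤ) (a b : ℤ) (y : ℝ) : ℝ := ∑ l ∈ LMset T N σ a b, wD T y l

/-- The length-sliced matrices on the `2T` levels (plumbing). [folklore] -/
def LUM (T N : ℕ) (σ : ℤ) (y : ℝ) : Matrix (Fin (2 * T)) (Fin (2 * T)) ℝ := fun a b => LUs T N σ (a : ℕ) (b : ℕ) y

/-- The length-sliced irreducible matrices (plumbing). [folklore] -/
def LMM (T N : ℕ) (σ : ℤ) (y : ℝ) : Matrix (Fin (2 * T)) (Fin (2 * T)) ℝ := fun a b => LMs T N σ (a : ℕ) (b : ℕ) y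

variable {N : ℕ} {y : ℝ} {σ : ℤ}

/-- Non-negativity of the sliced sums. [cite: DuminilCopinHammond2013, §2.2; lane plumbing] -/
theorem LUs_LMs_nonneg (hy : 0 ≤ y) (a b : ℤ) : 0 ≤ LUs T N σ a b y ∧ 0 ≤ LMs T N σ a b y :=
  ⟨sum_nonneg fun l _ => wD_nonneg T hy l, sum_nonneg fun l _ => wD_nonneg T hy l⟩

/-- `xstd` keeps the number of steps. [cite: DuminilCopinHammond2013, §2.2; lane plumbing] -/
theorem hlen_xstd (l : List HV) : hlen (xstd l) = hlen l := by rw [hlen, hlen, length_xstd]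

/-- A list with at least two vertices has at least one step. [cite: DuminilCopinHammond2013, §2.2; lane plumbing] -/
theorem one_le_hlen_of_two_le {l : List HV} (_hB : IsHBridge l) (h2 : 2 ≤ l.length) : 1 ≤ hlen l := by
  rw [hlen]; omega

/-- The number of steps splits additively at the first renewal index (the split vertex is shared). [cite: DuminilCopinHammond2013, §2.2 (decomposition at renewal points)] -/
theorem hlen_split {l : List HV} (h : (renIdxs l).Nonempty) : hlen l = hlen (fstP l) + hlen (sndP l) := by
  obtain ⟨h1, h2, h3, -⟩ := length_fstP_sndP h
  have hf := (fIdx_spec h).1.2.1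
  rw [hlen, hlen, hlen, h1, h2]; push_cast [Nat.cast_sub (show fIdx l ≤ l.length by omega)]; ring

/-- The slices `M_σ`, `σ ∈ s`, are disjoint parts of `I_N`: `Σ_{σ ∈ s} M_σ(y) ≤ I_N(y)` entrywise (`y ≥ 0`).
[cite: DuminilCopinHammond2013, §2.2] -/
theorem sum_LMM_le_Imat (hy : 0 ≤ y) (s : Finset ℤ) (a b : Fin (2 * T)) :
    (∑ σ ∈ s, LMM T N σ y) a b ≤ Imat T N y a b := by
  classical
  rw [Matrix.sum_apply]
  simp only [LMM, LMs, Imat, Dk]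
  have hdisj : Set.PairwiseDisjoint (s : Set ℤ) fun σ => LMset T N σ (a : ℕ) (b : ℕ) := by
    intro i _ i' _ hne
    rw [Function.onFun, disjoint_left]
    intro l h1 h2
    rw [LMset, mem_filter] at h1 h2
    exact hne (h1.2.symm.trans h2.2)
  rw [← sum_biUnion hdisj]
  refine sum_le_sum_of_subset_of_nonneg (fun l hl => ?_) fun _ _ _ => wD_nonneg T hy _
  rw [mem_biUnion] at hl
  obtain ⟨i, -, hi⟩ := hl
  exact (mem_filter.1 hi).1

end LenSliced

section Split

variable {T N : ℕ} {y : ℝ} {σ : ℤ}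

/-- No bridge with at least two vertices has `≤ 0` steps: `U_σ = 0` for `σ ≤ 0`. [cite: DuminilCopinHammond2013, §2.2; lane plumbing] -/
theorem LUM_eq_zero_of_le (hσ : σ ≤ 0) (y : ℝ) (a b : Fin (2 * T)) : LUM T N σ y a b = 0 := by
  rw [LUM, LUs]
  refine sum_eq_zero fun l hl => ?_
  exfalso
  rw [LUset, mem_filter, HBab, mem_filter, mem_hBridgesN_iff] at hl
  obtain ⟨⟨⟨-, -, -, -, -, hB⟩, h2, -, -⟩, hspan⟩ := hl
  have := one_le_hlen_of_two_le hB h2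
  omega

set_option maxHeartbeats 400000 in
/-- ★ **The length-sliced split inequality**: a bridge with `σ` steps is irreducible, or an irreducible bridge of span `τ ∈ [1, σ)` followed
by a bridge of span `σ − τ` (injectively, weights multiply):
`U_σ(a,b) ≤ M_σ(a,b) + Σ_{τ ∈ [1,σ)} Σ_c M_τ(a,c) U_{σ−τ}(c,b)`. [cite: DuminilCopinHammond2013, §2.2 (decomposition at the first renewal point)] -/
theorem LUM_le_split (hy : 0 ≤ y) (σ : ℤ) (a b : Fin (2 * T)) :
    LUM T N σ y a b ≤ LMM T N σ y a b + (∑ τ ∈ Finset.Ico (1 : ℤ) σ, LMM T N τ y * LUM T N (σ - τ) y) a b := by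
  classical
  set S := LUset T N σ (a : ℕ) (b : ℕ) with hS
  set Sirr := S.filter fun l => renIdxs l = ∅ with hSirr
  set Sred := S.filter fun l => renIdxs l ≠ ∅ with hSred
  have hmemS : ∀ l ∈ S, l.IsChain hvGraph.Adj ∧ l.Nodup ∧ l.length ≤ N + 1 ∧ (∃ v, l.head? = some v ∧ v.1 = 0) ∧ InLev T l ∧
      IsHBridge l ∧ 2 ≤ l.length ∧ hdLev l = a ∧ ltLev l = b ∧ hlen l = σ := by
    intro l hl
    rw [hS, LUset, mem_filter, HBab, mem_filter, mem_hBridgesN_iff] at hl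
    obtain ⟨⟨⟨hc, hnd, hlenN, hh, hin, hB⟩, h2, ha, hb⟩, hsz⟩ := hl
    exact ⟨hc, hnd, hlenN, hh, hin, hB, h2, ha, hb, hsz⟩
  -- (1) the irreducible part
  have hirr : ∑ l ∈ Sirr, wD T y l ≤ LMM T N σ y a b := by
    rw [LMM, LMs]
    refine sum_le_sum_of_subset_of_nonneg (fun l hl => ?_) fun _ _ _ => wD_nonneg T hy _
    rw [hSirr, mem_filter] at hl
    obtain ⟨hl, hren⟩ := hl
    obtain ⟨hc, hnd, hlenN, hh, hin, hB, h2, ha, hb, hsz⟩ := hmemS l hl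
    rw [LMset, mem_filter, HBk, mem_filter]
    exact ⟨⟨mem_hBridgesN_iff.2 ⟨hc, hnd, hlenN, hh, hin, hB⟩, h2, by rw [npieces, hren]; rfl, ha, hb⟩, hsz⟩
  -- (2) the reducible part: the split map into the double union
  set tgt : Finset (List HV × List HV) := (Finset.univ : Finset (Fin (2 * T))).biUnion fun c =>
    (Finset.Ico (1 : ℤ) σ).biUnion fun τ => LMset T N τ (a : ℕ) (c : ℕ) ×ˢ LUset T N (σ - τ) (c : ℕ) (b : ℕ) with htgt
  have himg : ∀ l ∈ Sred, (fstP l, xstd (sndP l)) ∈ tgt := by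
    intro l hl
    rw [hSred, mem_filter] at hl
    obtain ⟨hl, hren'⟩ := hl
    have hren : (renIdxs l).Nonempty := Finset.nonempty_iff_ne_empty.2 hren'
    obtain ⟨hc, hnd, hlenN, ⟨v, hv, hv0⟩, hin, hB, h2, ha, hb, hsz⟩ := hmemS l hl
    have hlens := length_fstP_sndP hren
    obtain ⟨hB1, hB2⟩ := isHBridge_fstP_sndP hB hren
    obtain ⟨e1, e2, e3, e4⟩ := fstP_sndP_ends hren
    obtain ⟨hne1, hne2⟩ := fstP_sndP_ne_nil hren
    have hl0 : l ≠ [] := by rintro rfl; simp at h2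
    have hspl := hlen_split hren
    have hf := (fIdx_spec hren).1
    have hlen1 : 2 ≤ (fstP l).length := by rw [fstP, List.length_take]; have := hf.1; have := hf.2.1; omega
    have hlen2 : 2 ≤ (sndP l).length := by rw [sndP, List.length_drop]; have := hf.2.1; omega
    have hτ1 : 1 ≤ hlen (fstP l) := one_le_hlen_of_two_le hB1 hlen1
    have hτ2 : 1 ≤ hlen (sndP l) := one_le_hlen_of_two_le hB2 hlen2
    set cz : ℤ := lev (l[fIdx l]'(by have := (fIdx_spec hren).1.2.1; omega)) with hcz
    have hcz0 : 0 ≤ cz ∧ cz ≤ 2 * (T : ℤ) - 1 := hin _ (List.getElem_mem _)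
    let c : Fin (2 * T) := ⟨cz.toNat, by omega⟩
    have hcc : ((c : ℕ) : ℤ) = cz := by simp [c]; omega
    rw [htgt, mem_biUnion]
    refine ⟨c, mem_univ _, ?_⟩
    rw [mem_biUnion]
    refine ⟨hlen (fstP l), Finset.mem_Ico.2 ⟨hτ1, by omega⟩, mem_product.2 ⟨?_, ?_⟩⟩
    · show fstP l ∈ LMset T N _ _ _
      rw [LMset, mem_filter, HBk, mem_filter, mem_hBridgesN_iff]
      refine ⟨⟨⟨hc.take _, hnd.sublist (List.take_sublist _ _), by omega, ⟨v, ?_, hv0⟩,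
        fun w hw => hin w ((List.take_sublist _ _).subset hw), hB1⟩, hlen1, by rw [npieces, renIdxs_fstP hren]; rfl, ?_, ?_⟩, rfl⟩
      · rw [fstP, List.head?_take, if_neg (by omega), hv]
      · rw [hdLev, fstP, List.head?_take, if_neg (by omega)]; rw [hdLev] at ha; exact ha
      · rw [ltLev, List.getLast?_eq_some_getLast hne1, Option.getD_some, e2, hcc]
    · show xstd (sndP l) ∈ LUset T N _ _ _
      rw [LUset, mem_filter, HBab, mem_filter, mem_hBridgesN_iff]
      have hv2 : (sndP l).head? = some (l[fIdx l]'(by have := (fIdx_spec hren).1.2.1; omega)) := by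
        rw [List.head?_eq_some_head hne2, e3]
      refine ⟨⟨⟨isChain_xstd (hc.drop _), nodup_xstd (hnd.sublist (List.drop_sublist _ _)), by rw [length_xstd]; omega,
        ⟨_, head?_xstd hv2, rfl⟩, inLev_xstd fun w hw => hin w ((List.drop_sublist _ _).subset hw), isHBridge_xstd hB2⟩,
        by rw [length_xstd]; exact hlen2, ?_, ?_⟩, by rw [hlen_xstd]; omega⟩
      · rw [hdLev, head?_xstd hv2, Option.getD_some, hcc, hcz]; simp [lev, bit]
      · rw [ltLev, xstd, List.getLast?_map, List.getLast?_eq_some_getLast hne2, Option.map_some, Option.getD_some, lev_shift_zero, e4]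
        rw [ltLev, List.getLast?_eq_some_getLast hl0, Option.getD_some] at hb; exact hb
  have hinj : Set.InjOn (fun l : List HV => (fstP l, xstd (sndP l))) (Sred : Set (List HV)) := by
    intro l hl l' hl' h
    rw [mem_coe, hSred, mem_filter] at hl hl'
    exact split_injOn (Finset.nonempty_iff_ne_empty.2 hl.2) (Finset.nonempty_iff_ne_empty.2 hl'.2) h
  have hred : ∑ l ∈ Sred, wD T y l ≤ (∑ τ ∈ Finset.Ico (1 : ℤ) σ, LMM T N τ y * LUM T N (σ - τ) y) a b := by
    calc ∑ l ∈ Sred, wD T y l = ∑ l ∈ Sred, wD T y (fstP l) * wD T y (xstd (sndP l)) := by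
          refine sum_congr rfl fun l hl => ?_
          rw [hSred, mem_filter] at hl
          rw [wD_eq_mul_fstP_sndP T y (Finset.nonempty_iff_ne_empty.2 hl.2)]
          congr 1
          rw [wD, wD, length_xstd, xstd, ← List.map_tail, topCnt_map_shift]
      _ = ∑ pq ∈ Sred.image fun l => (fstP l, xstd (sndP l)), wD T y pq.1 * wD T y pq.2 := by rw [sum_image hinj]
      _ ≤ ∑ pq ∈ tgt, wD T y pq.1 * wD T y pq.2 := by
          refine sum_le_sum_of_subset_of_nonneg (fun pq hpq => ?_) fun pq _ _ => mul_nonneg (wD_nonneg T hy _) (wD_nonneg T hy _)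
          rw [mem_image] at hpq
          obtain ⟨l, hl, rfl⟩ := hpq
          exact himg l hl
      _ = (∑ τ ∈ Finset.Ico (1 : ℤ) σ, LMM T N τ y * LUM T N (σ - τ) y) a b := by
          rw [Matrix.sum_apply, htgt, sum_biUnion]
          · have inner : ∀ c : Fin (2 * T), ∑ pq ∈ (Finset.Ico (1 : ℤ) σ).biUnion (fun τ =>
                LMset T N τ (a : ℕ) (c : ℕ) ×ˢ LUset T N (σ - τ) (c : ℕ) (b : ℕ)), wD T y pq.1 * wD T y pq.2 =
                ∑ τ ∈ Finset.Ico (1 : ℤ) σ, LMs T N τ (a : ℕ) (c : ℕ) y * LUs T N (σ - τ) (c : ℕ) (b : ℕ) y := by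
              intro c
              rw [sum_biUnion]
              · refine sum_congr rfl fun τ _ => ?_
                rw [sum_product, LMs, LUs, sum_mul_sum]
              · intro i _ i' _ hne
                rw [Function.onFun, disjoint_left]
                intro pq h1 h2
                rw [mem_product, LMset, mem_filter] at h1 h2
                exact hne (h1.1.2.symm.trans h2.1.2)
            simp_rw [inner]
            rw [sum_comm]
            refine sum_congr rfl fun τ _ => ?_
            rw [Matrix.mul_apply]; rfl
          · intro c _ c' _ hcc'
            rw [Function.onFun, disjoint_left]
            intro pq h1 h2
            rw [mem_biUnion] at h1 h2
            obtain ⟨i, -, h1⟩ := h1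
            obtain ⟨i', -, h2⟩ := h2
            rw [mem_product, LMset, mem_filter, HBk, mem_filter] at h1 h2
            have e1 := h1.1.1.2.2.2.2; have e2 := h2.1.1.2.2.2.2
            exact hcc' (Fin.ext (by have := e1.symm.trans e2; exact_mod_cast this))
  have hsplitS : ∑ l ∈ S, wD T y l = ∑ l ∈ Sirr, wD T y l + ∑ l ∈ Sred, wD T y l := by
    rw [hSirr, hSred, ← sum_filter_add_sum_filter_not S (fun l => renIdxs l = ∅)]
  calc LUM T N σ y a b = ∑ l ∈ S, wD T y l := rfl
    _ ≤ _ := by rw [hsplitS]; exact add_le_add hirr hred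

end Split

/-! ### §3 The sub-invariant vector and the uniform bound below the threshold -/

section Analytic

variable {T N : ℕ} {y : ℝ}

/-- Iterating `A s ≤ s` for `A ≥ 0`: `A^k s ≤ s`. [cite: Seneta1973, §6.2 (sub-invariant vectors)] (Edition 4: `private` — statement-twin of `HV.pow_mulVec_le_of_mulVec_le` in `HexSAWStripThresholdPointwise.lean`, which this file does not import.) -/
private theorem pow_mulVec_le_of_subInvariant' {ι : Type*} [Fintype ι] [DecidableEq ι] {A : Matrix ι ι ℝ} (hA : ∀ a b, 0 ≤ A a b)
    {s : ι → ℝ} (hs : A *ᵥ s ≤ s) (k : ℕ) : (A ^ k) *ᵥ s ≤ s := by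
  induction k with
  | zero => simp
  | succ k ih =>
    rw [pow_succ', ← Matrix.mulVec_mulVec]
    exact (nonnegMat_mulVec_le_mulVec_of_le hA ih).trans hs

/-- `Σ_{σ ∈ s} M_σ(y) ≤ I(y)` entrywise for `y ∈ [1, y_T)`. [cite: DuminilCopinHammond2013, §2.2] -/
theorem sum_LMM_le_Iinf (hT : 1 ≤ T) (hy : y ∈ Set.Ico 1 (stripYT T)) (s : Finset ℤ) (a b : Fin (2 * T)) :
    (∑ σ ∈ s, LMM T N σ y) a b ≤ Iinf T y a b :=
  (sum_LMM_le_Imat (sub_threshold_of_mem_Ico hT hy).2.1 s a b).trans (Imat_le_Iinf hT hy N a b)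

/-- `M_σ ≥ 0`, `U_σ ≥ 0` entrywise (`y ≥ 0`). [cite: DuminilCopinHammond2013, §2.2; lane plumbing] -/
theorem LMM_LUM_nonneg (hy : 0 ≤ y) (σ : ℤ) (a b : Fin (2 * T)) : 0 ≤ LMM T N σ y a b ∧ 0 ≤ LUM T N σ y a b :=
  ⟨(LUs_LMs_nonneg (T := T) (N := N) (σ := σ) hy _ _).2, (LUs_LMs_nonneg (T := T) (N := N) (σ := σ) hy _ _).1⟩

/-- Powers of `I(y)` are summable entrywise below the threshold. [cite: BeatonBousquetMelouDeGierDuminilCopinGuttmann2014, Corollary 8; Seneta1973, §6.1] (Edition 4: `private` — statement-twin of `HV.summable_pow_Iinf` in `HexSAWStripThresholdPointwise.lean`, which this file does not import.) -/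
private theorem summable_pow_Iinf' (hT : 1 ≤ T) (hy : y ∈ Set.Ico 1 (stripYT T)) (a b : Fin (2 * T)) :
    Summable fun k => (Iinf T y ^ k) a b := by
  obtain ⟨B, hB⟩ := exists_partialSum_pow_Iinf_le hT hy
  refine summable_of_sum_range_le (fun k => nonnegMat_pow_apply_nonneg (Iinf_nonneg hT hy) k a b) (c := B) fun n => ?_
  rw [← Matrix.sum_apply]; exact hB n a b

/-- ★★ **The length slices are sub-invariant**: for a sub-invariant vector `s` of `I(y)` (`I(y) s ≤ s`, `y ∈ [1, y_T)`),
`U_σ(y) s ≤ s` for every step count `σ` — by strong induction on `σ`: `U_σ s ≤ M_σ s + Σ_{τ<σ} M_τ U_{σ−τ} s ≤ (Σ_{τ ≤ σ} M_τ) s ≤ I s ≤ s`.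
[cite: Seneta1973, §6.2 Theorem 6.3 (sub-invariant vectors); DuminilCopinHammond2013, §2.2; lane] -/
theorem LUM_mulVec_le_of_subInvariant (hT : 1 ≤ T) (hy : y ∈ Set.Ico 1 (stripYT T)) {s : Fin (2 * T) → ℝ} (hs0 : 0 ≤ s)
    (hAs : Iinf T y *ᵥ s ≤ s) (σ : ℤ) : LUM T N σ y *ᵥ s ≤ s := by
  classical
  have hy0 : 0 ≤ y := (sub_threshold_of_mem_Ico hT hy).2.1
  -- strong induction over the integer span via `n : ℕ` with `σ ≤ n`
  suffices key : ∀ n : ℕ, ∀ σ : ℤ, σ ≤ n → LUM T N σ y *ᵥ s ≤ s from key σ.toNat σ (Int.self_le_toNat σ)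
  intro n
  induction n with
  | zero =>
    intro σ hσ
    have h0 : LUM T N σ y = 0 := by ext a b; exact LUM_eq_zero_of_le (by omega) y a b
    rw [h0, Matrix.zero_mulVec]; exact hs0
  | succ n ih =>
    intro σ hσ
    rcases lt_or_eq_of_le hσ with hlt | heq
    · exact ih σ (by omega)
    · -- σ = n + 1 ≥ 1
      have hsplit : LUM T N σ y *ᵥ s ≤ LMM T N σ y *ᵥ s + ∑ τ ∈ Finset.Ico (1 : ℤ) σ, LMM T N τ y *ᵥ (LUM T N (σ - τ) y *ᵥ s) := by
        have h1 : LUM T N σ y *ᵥ s ≤ (LMM T N σ y + ∑ τ ∈ Finset.Ico (1 : ℤ) σ, LMM T N τ y * LUM T N (σ - τ) y) *ᵥ s :=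
          nonnegMat_mulVec_le_mulVec_of_entry_le (fun a b => LUM_le_split hy0 σ a b) hs0
        refine h1.trans (le_of_eq ?_)
        rw [Matrix.add_mulVec, Matrix.sum_mulVec]
        congr 1
        exact sum_congr rfl fun i _ => (Matrix.mulVec_mulVec _ _ _).symm
      have hterm : ∀ τ ∈ Finset.Ico (1 : ℤ) σ, LMM T N τ y *ᵥ (LUM T N (σ - τ) y *ᵥ s) ≤ LMM T N τ y *ᵥ s := fun τ hτ =>
        nonnegMat_mulVec_le_mulVec_of_le (fun a b => (LMM_LUM_nonneg hy0 τ a b).1) (ih (σ - τ) (by rw [Finset.mem_Ico] at hτ; omega))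
      have hsum : ∑ τ ∈ Finset.Ico (1 : ℤ) σ, LMM T N τ y *ᵥ (LUM T N (σ - τ) y *ᵥ s) ≤ (∑ τ ∈ Finset.Ico (1 : ℤ) σ, LMM T N τ y) *ᵥ s := by
        rw [Matrix.sum_mulVec]; exact sum_le_sum hterm
      have hall : LMM T N σ y *ᵥ s + (∑ τ ∈ Finset.Ico (1 : ℤ) σ, LMM T N τ y) *ᵥ s = (∑ τ ∈ Finset.Icc (1 : ℤ) σ, LMM T N τ y) *ᵥ s := by
        rw [← Matrix.add_mulVec]
        congr 1
        have hσ1 : (1 : ℤ) ≤ σ := by omega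
        rw [← Finset.Ico_insert_right hσ1, sum_insert Finset.right_notMem_Ico, add_comm]
      have hIs : (∑ τ ∈ Finset.Icc (1 : ℤ) σ, LMM T N τ y) *ᵥ s ≤ s :=
        (nonnegMat_mulVec_le_mulVec_of_entry_le (fun a b => sum_LMM_le_Iinf hT hy _ a b) hs0).trans hAs
      calc LUM T N σ y *ᵥ s ≤ LMM T N σ y *ᵥ s + ∑ τ ∈ Finset.Ico (1 : ℤ) σ, LMM T N τ y *ᵥ (LUM T N (σ - τ) y *ᵥ s) := hsplit
        _ ≤ LMM T N σ y *ᵥ s + (∑ τ ∈ Finset.Ico (1 : ℤ) σ, LMM T N τ y) *ᵥ s := add_le_add le_rfl hsum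
        _ = (∑ τ ∈ Finset.Icc (1 : ℤ) σ, LMM T N τ y) *ᵥ s := hall
        _ ≤ s := hIs

/-- ★★ **The uniform bound on the length slices below the threshold**: there is `K = K(T)` with `U_σ(a,b)(y) ≤ K` for all
`y ∈ [1, y_T)`, `N`, `σ`, `a`, `b` (sub-invariant vector of `I(y)` from the tree's `nonnegMat_exists_subInvariant_vector`, and the ratio bound
`s_b ≤ K_r s_a` from the irreducibility witnesses at `y = 1`).
[cite: Seneta1973, §6.1 Theorem 6.1 and §6.2 Theorem 6.3; DuminilCopinHammond2013, §2.2; lane] -/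
theorem exists_LUM_le (hT : 1 ≤ T) :
    ∃ K : ℝ, ∀ y ∈ Set.Ico (1 : ℝ) (stripYT T), ∀ N (σ : ℤ) (a b : Fin (2 * T)), LUM T N σ y a b ≤ K := by
  classical
  have h1T := one_lt_stripYT hT
  have h1mem : (1 : ℝ) ∈ Set.Ico (1 : ℝ) (stripYT T) := ⟨le_rfl, h1T⟩
  -- irreducibility witnesses at `y = 1` (from `I_2(1) ≤ I(1)`)
  have hwit : ∀ ab : Fin (2 * T) × Fin (2 * T), ∃ j : ℕ, 0 < (Iinf T 1 ^ j) ab.1 ab.2 := by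
    intro ab
    obtain ⟨j, hj⟩ := reach_Imat_all hT (N := 2) le_rfl ab.1 ab.2
    exact ⟨j, hj.trans_le (nonnegMat_pow_apply_mono (fun a b => (Imat_Dmat_nonneg (N := 2) (k := 1) zero_le_one a b).1)
      (fun a b => Imat_le_Iinf hT h1mem 2 a b) j ab.1 ab.2)⟩
  choose jw hjw using hwit
  set Kr : ℝ := ∑ ab : Fin (2 * T) × Fin (2 * T), 1 / (Iinf T 1 ^ jw ab) ab.1 ab.2 with hKr
  have hKr_ge : ∀ a b : Fin (2 * T), 1 / (Iinf T 1 ^ jw (a, b)) a b ≤ Kr := fun a b =>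
    single_le_sum (f := fun ab : Fin (2 * T) × Fin (2 * T) => 1 / (Iinf T 1 ^ jw ab) ab.1 ab.2)
      (fun ab _ => (one_div_pos.2 (hjw ab)).le) (mem_univ (a, b))
  refine ⟨Kr, fun y hy N σ a b => ?_⟩
  have hy0 : 0 ≤ y := (sub_threshold_of_mem_Ico hT hy).2.1
  have hy1 : 1 ≤ y := hy.1
  have hA := Iinf_nonneg hT hy
  obtain ⟨s, hs1, hAs, -⟩ := nonnegMat_exists_subInvariant_vector hA (summable_pow_Iinf' hT hy)
  have hs0 : 0 ≤ s := fun a => zero_le_one.trans (hs1 a)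
  have hspos : ∀ a, 0 < s a := fun a => zero_lt_one.trans_le (hs1 a)
  -- ratio bound: `s b ≤ Kr · s a`
  have hratio : ∀ a b, s b ≤ Kr * s a := by
    intro a b
    have hmono : (Iinf T 1 ^ jw (a, b)) a b ≤ (Iinf T y ^ jw (a, b)) a b :=
      nonnegMat_pow_apply_mono (Iinf_nonneg hT h1mem)
        (fun a b => ciSup_le fun N => (Imat_mono_y zero_le_one hy1 a b).trans (Imat_le_Iinf hT hy N a b)) _ a b
    have h1 : (Iinf T y ^ jw (a, b)) a b * s b ≤ s a :=
      (nonnegMat_apply_mul_le_mulVec (nonnegMat_pow_apply_nonneg hA _) hs0 a b).trans (pow_mulVec_le_of_subInvariant' hA hAs _ a)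
    have hw := hjw (a, b)
    have h2 : (Iinf T 1 ^ jw (a, b)) a b * s b ≤ s a := (mul_le_mul_of_nonneg_right hmono (hs0 b)).trans h1
    calc s b = (1 / (Iinf T 1 ^ jw (a, b)) a b) * ((Iinf T 1 ^ jw (a, b)) a b * s b) := by field_simp
      _ ≤ (1 / (Iinf T 1 ^ jw (a, b)) a b) * s a := mul_le_mul_of_nonneg_left h2 (one_div_pos.2 hw).le
      _ ≤ Kr * s a := mul_le_mul_of_nonneg_right (hKr_ge a b) (hs0 a)
  -- `U_σ(a,b) s_b ≤ (U_σ s)_a ≤ s_a ≤ Kr s_b`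
  have hUs := LUM_mulVec_le_of_subInvariant (N := N) hT hy hs0 hAs σ a
  have h1 : LUM T N σ y a b * s b ≤ (LUM T N σ y *ᵥ s) a :=
    nonnegMat_apply_mul_le_mulVec (fun a b => (LMM_LUM_nonneg hy0 σ a b).2) hs0 a b
  have h2 : LUM T N σ y a b * s b ≤ Kr * s b := (h1.trans hUs).trans (hratio b a)
  exact le_of_mul_le_mul_right h2 (hspos b)

/-- ★★★ **The horizontal bridges of exact span `σ` at the threshold are uniformly bounded**: there is `K = K(T)` with
`LUs T N σ a b (y_T) = Σ_{h : a → b standard horizontal bridge, ≤ N+1 vertices, span σ} x_c^{|h|−1} y_T^{#top(h.tail)} ≤ K` for all `N, σ, a, b`.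
(Continuity of the finite sum at `y_T` from the left.)  The span analogue of the pointwise threshold law for contacts.
[cite: DuminilCopinHammond2013, §2.2; Seneta1973, §6.2 Theorem 6.3; BeatonBousquetMelouDeGierDuminilCopinGuttmann2014, Corollary 8 (y_T); lane: NEW] -/
theorem exists_LUs_stripYT_le (hT : 1 ≤ T) :
    ∃ K : ℝ, ∀ N (σ : ℤ) (a b : Fin (2 * T)), LUs T N σ (a : ℕ) (b : ℕ) (stripYT T) ≤ K := by
  obtain ⟨K, hK⟩ := exists_LUM_le hT
  have h1T := one_lt_stripYT hT
  refine ⟨K, fun N σ a b => ?_⟩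
  have hcont : ContinuousAt (fun y : ℝ => LUs T N σ (a : ℕ) (b : ℕ) y) (stripYT T) := by
    unfold LUs wD
    exact (continuous_finsetSum _ fun l _ => continuous_const.mul (continuous_pow _)).continuousAt
  have hlim : Tendsto (fun y : ℝ => LUs T N σ (a : ℕ) (b : ℕ) y) (𝓝[<] stripYT T) (𝓝 (LUs T N σ (a : ℕ) (b : ℕ) (stripYT T))) :=
    tendsto_nhdsWithin_of_tendsto_nhds hcont.tendsto
  refine le_of_tendsto hlim ?_
  have hmem : Set.Ico (1 : ℝ) (stripYT T) ∈ 𝓝[<] stripYT T := Ico_mem_nhdsLT h1T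
  filter_upwards [hmem] with y hy
  exact hK y hy N σ a b

end Analytic


/-! ### §4 ★★★ The length-pointwise law for the horizontal-bridge series at the threshold -/

section Headline

variable {T : ℕ}

/-- `x_c^{|h|} y^{#top(h)} ≤ x_c · max(1,y) · wD(h)` for a nonempty list (the start vertex carries at most one contact).
[cite: BeatonBousquetMelouDeGierDuminilCopinGuttmann2014, §3.2 (weights); lane plumbing] -/
theorem pow_mul_pow_topCnt_le_wD' {y : ℝ} (hy : 0 ≤ y) {l : List HV} (hl : l ≠ []) :
    hexCriticalFugacity ^ l.length * y ^ topCnt T l ≤ hexCriticalFugacity * max 1 y * wD T y l := by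
  have hx := hexCriticalFugacity_pos_lt_one.1
  obtain ⟨v, t, rfl⟩ := List.exists_cons_of_ne_nil hl
  rw [wD, List.length_cons, Nat.add_sub_cancel, List.tail_cons, topCnt_cons, pow_succ, pow_add]
  have h1 : y ^ (if lev v = 2 * (T : ℤ) - 1 then 1 else 0) ≤ max 1 y := by
    split_ifs
    · rw [pow_one]; exact le_max_right _ _
    · rw [pow_zero]; exact le_max_left _ _
  have h2 : 0 ≤ hexCriticalFugacity ^ t.length * y ^ topCnt T t := mul_nonneg (pow_nonneg hx.le _) (pow_nonneg hy _)
  calc hexCriticalFugacity ^ t.length * hexCriticalFugacity * (y ^ (if lev v = 2 * (T : ℤ) - 1 then 1 else 0) * y ^ topCnt T t)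
      = (y ^ (if lev v = 2 * (T : ℤ) - 1 then 1 else 0)) * (hexCriticalFugacity * (hexCriticalFugacity ^ t.length * y ^ topCnt T t)) := by
        ring
    _ ≤ max 1 y * (hexCriticalFugacity * (hexCriticalFugacity ^ t.length * y ^ topCnt T t)) :=
        mul_le_mul_of_nonneg_right h1 (mul_nonneg hx.le h2)
    _ = hexCriticalFugacity * max 1 y * (hexCriticalFugacity ^ t.length * y ^ topCnt T t) := by ring

/-- ★★★ **LENGTH-POINTWISE LAW**: there is `K = K(T)` such that for every truncation `N` and every `σ`, the standard horizontal bridges of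
`S_T` with at least two vertices and exactly `σ` steps have total weight `Σ x_c^{|h|} y_T^{#top(h)} ≤ K` at the threshold `y_T` —
uniformly in `σ` (and `N`).
[cite: DuminilCopinHammond2013, §2.2 (bridges, renewal structure); Seneta1973, §6.2 Theorem 6.3; BeatonBousquetMelouDeGierDuminilCopinGuttmann2014, Corollary 8 (y_T); lane «pcv-sawmu»: NEW] -/
theorem exists_hBridgesN_length_stripYT_le (hT : 1 ≤ T) :
    ∃ K : ℝ, ∀ N (σ : ℤ), ∑ l ∈ (hBridgesN T N).filter (fun l => 2 ≤ l.length ∧ hlen l = σ),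
      hexCriticalFugacity ^ l.length * stripYT T ^ topCnt T l ≤ K := by
  classical
  obtain ⟨K, hK⟩ := exists_LUs_stripYT_le hT
  have hy := (stripYT_pos hT).le
  have hx := hexCriticalFugacity_pos_lt_one.1
  have hK0 : 0 ≤ K := le_trans (LUs_LMs_nonneg (T := T) (N := 0) (σ := 0) hy 0 0).1 (hK 0 0 ⟨0, by omega⟩ ⟨0, by omega⟩)
  set F : ℝ := (Fintype.card (Fin (2 * T) × Fin (2 * T)) : ℝ) with hF
  refine ⟨hexCriticalFugacity * max 1 (stripYT T) * (F * K), fun N σ => ?_⟩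
  set S := (hBridgesN T N).filter (fun l => 2 ≤ l.length ∧ hlen l = σ) with hS
  -- S ⊆ ⋃_{(a,b)} LUset σ a b, a disjoint union
  have hsub : S ⊆ (Finset.univ : Finset (Fin (2 * T) × Fin (2 * T))).biUnion fun ab => LUset T N σ (ab.1 : ℕ) (ab.2 : ℕ) := by
    intro l hl
    rw [hS, mem_filter] at hl
    obtain ⟨hl, h2, hσ⟩ := hl
    have hl' := hl
    rw [mem_hBridgesN_iff] at hl'
    obtain ⟨-, -, -, -, hin, -⟩ := hl'
    have hne : l ≠ [] := by rintro rfl; simp at h2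
    obtain ⟨ha0, ha1, hb0, hb1⟩ := hdLev_ltLev_bounds (T := T) hin hne
    let a : Fin (2 * T) := ⟨(hdLev l).toNat, by omega⟩
    let b : Fin (2 * T) := ⟨(ltLev l).toNat, by omega⟩
    rw [mem_biUnion]
    refine ⟨(a, b), mem_univ _, ?_⟩
    rw [LUset, mem_filter, HBab, mem_filter]
    exact ⟨⟨hl, h2, by simp [a]; omega, by simp [b]; omega⟩, hσ⟩
  have hdisj : Set.PairwiseDisjoint ((Finset.univ : Finset (Fin (2 * T) × Fin (2 * T))) : Set (Fin (2 * T) × Fin (2 * T)))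
      fun ab : Fin (2 * T) × Fin (2 * T) => LUset T N σ (ab.1 : ℕ) (ab.2 : ℕ) := by
    intro ab _ ab' _ hne
    rw [Function.onFun, disjoint_left]
    intro l h1 h2
    rw [LUset, mem_filter, HBab, mem_filter] at h1 h2
    apply hne
    have e1 : (ab.1 : ℤ) = ab'.1 := h1.1.2.2.1.symm.trans h2.1.2.2.1
    have e2 : (ab.2 : ℤ) = ab'.2 := h1.1.2.2.2.symm.trans h2.1.2.2.2
    exact Prod.ext (Fin.ext (by exact_mod_cast e1)) (Fin.ext (by exact_mod_cast e2))
  calc ∑ l ∈ S, hexCriticalFugacity ^ l.length * stripYT T ^ topCnt T l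
      ≤ ∑ l ∈ (Finset.univ : Finset (Fin (2 * T) × Fin (2 * T))).biUnion (fun ab => LUset T N σ (ab.1 : ℕ) (ab.2 : ℕ)),
          hexCriticalFugacity ^ l.length * stripYT T ^ topCnt T l :=
        sum_le_sum_of_subset_of_nonneg hsub fun l _ _ => mul_nonneg (pow_nonneg hx.le _) (pow_nonneg hy _)
    _ = ∑ ab : Fin (2 * T) × Fin (2 * T), ∑ l ∈ LUset T N σ (ab.1 : ℕ) (ab.2 : ℕ),
          hexCriticalFugacity ^ l.length * stripYT T ^ topCnt T l := sum_biUnion hdisj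
    _ ≤ ∑ ab : Fin (2 * T) × Fin (2 * T), hexCriticalFugacity * max 1 (stripYT T) * K := by
        refine sum_le_sum fun ab _ => ?_
        calc ∑ l ∈ LUset T N σ (ab.1 : ℕ) (ab.2 : ℕ), hexCriticalFugacity ^ l.length * stripYT T ^ topCnt T l
            ≤ ∑ l ∈ LUset T N σ (ab.1 : ℕ) (ab.2 : ℕ), hexCriticalFugacity * max 1 (stripYT T) * wD T (stripYT T) l := by
              refine sum_le_sum fun l hl => pow_mul_pow_topCnt_le_wD' hy ?_
              rw [LUset, mem_filter, HBab, mem_filter] at hl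
              rintro rfl; have := hl.1.2.1; simp at this
          _ = hexCriticalFugacity * max 1 (stripYT T) * LUs T N σ (ab.1 : ℕ) (ab.2 : ℕ) (stripYT T) := by rw [LUs, mul_sum]
          _ ≤ hexCriticalFugacity * max 1 (stripYT T) * K :=
              mul_le_mul_of_nonneg_left (hK N σ ab.1 ab.2) (by positivity)
    _ = hexCriticalFugacity * max 1 (stripYT T) * (F * K) := by rw [sum_const, nsmul_eq_mul, hF, Finset.card_univ]; ring

end Headline

end Literature.Probability.RandomPlanarGeometry.SAW.HV
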